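import Literature.AnabelianGeometry.EtaleTheta.Discharge.Sec5UnitsFixedByGeometricOfCnst
import Literature.AnabelianGeometry.EtaleTheta.Discharge.Sec5OfConnectedTemperoid
import Literature.AlgebraicGeometry.Frobenioids.QuasiTemperoidPushforward

/-!
# [EtTh] §3/§5 ORIGIN CLAUSES at the [FrdII] Ex. 1.3 (ii) constant-field functor: `D → D₀ → D^cnst` induced by
# `Π^tp_X ↠ G_K` kills geometric automorphisms and sees `Π^tp_Y̲`, `Π^tp_Ÿ̲` alike (pp. 298, 322, 331 / PDF pp. 72, 96, 105)

Mochizuki, *The étale theta function and its Frobenioid-theoretic manifestations*, Publ. RIMS **45** (2009)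
[cite: MochizukiEtTh2009, §3 p.298 (PDF p.72); §5 p.322 (PDF p.96); Lem 5.8 p.331 (PDF p.105)]; Mochizuki, *The geometry of
Frobenioids II*, Kyushu J. Math. **62** (2008), Ex. 1.3 (ii) p.11 [cite: MochizukiFrdII2008, Ex 1.3 (ii) p.11]; Mochizuki,
*Semi-graphs of anabelioids*, Publ. RIMS **42** (2006), Rmk. 3.1.3 p.34 [cite: MochizukiSemiAnbd2006, Rmk 3.1.3 p.34].
abc-iut cell, cross-layer piece by signature for layer L2 (seat abc-iut-w4-d008, gen 4).  PROOF-ONLY, 0 definitions, no new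
named fact; over abc-iut-L1-t4/L6-t8's `QuasiTemperoid.pushforward` (the functor `φ_* : B^temp(Π₁)⁰ → B^temp(Π₂)⁰`,
`E ↦ E/Ker(φ)`, CONSTRUCTED in `QuasiTemperoidPushforward.lean`), abc-iut-w5-d013's canonical Galois surjections
`galoisSurjOf` (`Discharge/Sec4GaloisSurjNaturalModel.lean`) and abc-iut-L2-t4's genuine §5 data
`ThetaFrobenioid.ofConnectedTemperoidData` over `B^temp(Π^tp_X)⁰` (`Discharge/Sec5OfConnectedTemperoid.lean`).

WHAT.  §3 p.298 (PDF p.72): "the natural surjection `Π^tp_X ↠ G_K` determines a natural functor `D₀ → D^cnst` [cf. [FrdII],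
Example 1.3, (ii)]" — i.e. the composite `D = B^temp(Π^tp_X)⁰ → D₀ → D^cnst` is, up to the inclusion `D^cnst = B(G_K)⁰ ⊆
B^temp(G_K)⁰`, the PUSH-FORWARD `aug_*` along the augmentation.  Two «origin clause» binders of the §5 discharge files are
statements about that composite: abc-iut-w5-d020's `hΔcnst` (GAP-LEDGER G-w5d020-2, `Discharge/Sec5UnitsFixedByGeometricOfCnst`:
"`cnst` maps `ρ_N(δ)`, `δ` geometric, to the identity") and this seat's `hcnst` (residual of G-L2d4-1,
`Discharge/Sec5UnitsConjFactorsThroughCnst`, p432786: "every `y ∈ Im(Π^tp_Y̲)` has the same image in `Aut_{D^cnst}((B_N^bs)^cnst)`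
as some `h ∈ Im(Π^tp_Ÿ̲)`").  Here both are PROVED for every composite of that shape:
* (A) `CnstPushforward.pushforward_map_eq_of_apply` — two maps of connected `Π₁`-sets that differ by `Ker(φ)` at ONE point have the
  same push-forward; **`pushforward_map_galoisSurjOf_eq`**: `φ(g) = φ(g') ⇒ φ_*(galoisSurjOf_A(g)) = φ_*(galoisSurjOf_A(g'))` for every
  Galois object `A` (the canonical surjection is right translation `a·x_A ↦ a g⁻¹·x_A`, [SemiAnbd] Rmk. 3.1.3, and `a g⁻¹·x_A`,
  `a g'⁻¹·x_A` differ by `a g'⁻¹ g a⁻¹ ∈ Ker(φ)`); `pushforward_map_galoisSurjOf_of_ker`: `= id` for `g ∈ Ker(φ)`;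
* (B) (private) transfer lemmas: along `Iso.conjAut` (the §5 `ρ_N` is `((s^⊓_N)^bs).conjAut ∘ galoisSurj_{A_N} ∘ ιX`,
  `rhoOfBiKummerData_apply`) and along any identification `e : F ≅ P ⋙ G` of functors;
* (C) at `ofConnectedTemperoidData` over `BiKummerSetting.mkOfConnectedTemperoid X tf …`, for ANY functors `tf.base : D ⥤ D₀`,
  `cnst : D₀ ⥤ D^cnst` and ANY identification `e : tf.base ⋙ cnst ≅ aug_* ⋙ G` (print's sentence; `aug_* :=
  QuasiTemperoid.pushforward X.aug`, `X.aug` assumed OPEN): **`cnst_map_base_rho_eq_of_aug_eq`** (`aug(ιX y) = aug(ιX y') ⇒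
  cnst(base(ρ_N y)) = cnst(base(ρ_N y'))`), **`cnst_map_base_rho_eq_id_of_aug_eq_one`** (the `hΔcnst` shape),
  **`hcnst_ofConnectedTemperoidData_of_pushforward`** (`hcnst` ⟸ `hYdd` : «`aug(ιX Π^tp_Ÿ̲)` exhausts `aug(ιX Π^tp_X̲)`» — `Ÿ`
  geometrically connected over `K = K̈`, §5 p.322), and **`hconstΔ_ofConnectedTemperoidData_of_pushforward`** = abc-iut-w5-d020's
  T56-L09b binder `hconst` (geometric `δ` fix the unit components) from `Prop34Cnst` + `e` + «`T.aug.ker` is geometric for `X.aug`».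
So the two origin-clause GAP residuals reduce to the DEFINITIONAL identification `e` of `D → D^cnst` with `aug_*` (+ openness of
`aug`, + `hYdd`); composing `hcnst_…` with p432786's `hfac_ofConnectedTemperoidData_of_cnst` gives the binder `hfac` of G-L2d4-1
from `{Prop34Cnst, e, hYdd}` (left to the consumer so that this file does not wait on that module's olean).
HONEST FRAMING: kernel-checked category/group theory over the typed interfaces; the tempered Frobenioid `tf` over
`B^temp(Π^tp_X)⁰` stays an abstract parameter (not inhabited for a curve); nothing of [EtTh] §5 is asserted; typed ≠ proved;
no side taken on [IUTchIII] Cor. 3.12.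
-/

noncomputable section

namespace Literature.AnabelianGeometry.EtaleTheta

open CategoryTheory Opposite Literature.AlgebraicGeometry.Frobenioids Literature.AlgebraicGeometry.Frobenioids.QuasiTemperoid
  Literature.AnabelianGeometry.SemiGraphs Literature.AnabelianGeometry.SemiGraphs.GaloisObjects

universe u₀ v₀ u₁ v₁ u₂ v₂ u₃ v₃ u v w

/-! ### (B) Two transfer lemmas -/

namespace CnstPushforward

/-- Functors respect conjugation of automorphisms along an isomorphism: if `F(e) = F(e')` then
`F(β.conjAut e) = F(β.conjAut e')`. [folklore] -/
private theorem map_conjAut_hom_eq {C : Type u₂} [Category.{v₂} C] {E : Type u₃} [Category.{v₃} E] (F : C ⥤ E) {A B : C}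
    (β : A ≅ B) {e e' : Aut A} (h : F.map e.hom = F.map e'.hom) :
    F.map (β.conjAut e).hom = F.map (β.conjAut e').hom := by
  rw [Iso.conjAut_hom, Iso.conjAut_hom, Iso.conj_apply, Iso.conj_apply, F.map_comp, F.map_comp, F.map_comp,
    F.map_comp, h]

/-- If `F ≅ P ⋙ G` then `P(f) = P(f')` implies `F(f) = F(f')`. [folklore] -/
private theorem map_eq_of_iso_comp {C : Type u₁} [Category.{v₁} C] {D' : Type u₂} [Category.{v₂} D'] {E : Type u₃}
    [Category.{v₃} E] {F : C ⥤ E} {P : C ⥤ D'} {G : D' ⥤ E} (e : F ≅ P ⋙ G) {A B : C} {f f' : A ⟶ B}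
    (h : P.map f = P.map f') : F.map f = F.map f' := by
  rw [← cancel_mono (e.hom.app B), e.hom.naturality, e.hom.naturality, Functor.comp_map, Functor.comp_map, h]

/-! ### (A) [FrdII] Ex. 1.3 (ii) `φ_*` on the canonical Galois surjections of [SemiAnbd] Rmk. 3.1.3 -/

variable {G₁ : Type u} [Group G₁] [TopologicalSpace G₁] [IsTopologicalGroup G₁] {G₂ : Type u} [Group G₂]
  [TopologicalSpace G₂] (φ : G₁ →* G₂) (hs : Function.Surjective φ) (hφ : IsOpenMap φ)

/-- **Two morphisms `f, f' : A → B` of `B^temp(Π₁)⁰` which differ by an element of `Ker(φ)` at ONE point of the (connected)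
source have the same push-forward `φ_*(f) = φ_*(f') : A/Ker(φ) → B/Ker(φ)`** ([FrdII] Ex. 1.3 (ii): `φ_*` is "taking the set of
`Ker(φ)`-orbits"; equivariance spreads the relation from one point to its `Π₁`-orbit, `Ker(φ)` being normal).
[cite: MochizukiFrdII2008, Ex 1.3 (ii) p.11] -/
theorem pushforward_map_eq_of_apply {A B : ConnectedPart (BTemp G₁)} (f f' : A ⟶ B) (x₀ : A.obj.obj.V) (k : G₁)
    (hk : φ k = 1) (hx : B.obj.obj.ρ k (f.hom.hom.hom x₀) = f'.hom.hom.hom x₀) :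
    (pushforward φ hs hφ).map f = (pushforward φ hs hφ).map f' := by
  apply ObjectProperty.hom_ext
  change (orbits φ hs hφ).map f.hom = (orbits φ hs hφ).map f'.hom
  apply BTempConnected.hom_ext_apply
  intro q
  induction q using Quotient.ind with
  | _ x =>
    obtain ⟨a, rfl⟩ := BTempConnected.exists_ρ_eq_of_isConnectedObj A.obj A.property x₀ x
    change (orbitMk (f.hom.hom.hom (A.obj.obj.ρ a x₀)) : OrbitSet φ B.obj) = orbitMk (f'.hom.hom.hom (A.obj.obj.ρ a x₀))
    rw [BTempConnected.hom_ρ, BTempConnected.hom_ρ, orbitMk_eq_iff]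
    refine ⟨a * k * a⁻¹, ?_, ?_⟩
    · rw [map_mul, map_mul, hk, mul_one, map_inv, mul_inv_cancel]
    · rw [BTempConnected.ρ_mul_apply, BTempConnected.ρ_mul_apply, BTempConnected.ρ_inv_apply, hx]

/-- **`φ(g) = φ(g')` ⇒ `φ_*(galoisSurjOf_A(g)) = φ_*(galoisSurjOf_A(g'))`** for a Galois object `A` of `B^temp(Π₁)`: the canonical
Galois surjection is right translation, `galoisSurjOf_A(g)(a·x_A) = (a g⁻¹)·x_A` ([SemiAnbd] Rmk. 3.1.3; abc-iut-w5-d013's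
`galoisSurjOf_apply_base`), and `(g'⁻¹ g)·(g⁻¹·x_A) = g'⁻¹·x_A` with `g'⁻¹ g ∈ Ker(φ)`.  This is the content of "the natural
functor `D₀ → D^cnst` determined by `Π^tp_X ↠ G_K`" ([EtTh] §3 p.298) on automorphisms: it only sees `aug(g)`.
[cite: MochizukiFrdII2008, Ex 1.3 (ii) p.11] -/
theorem pushforward_map_galoisSurjOf_eq (hG : IsTempered G₁) (A : ConnectedPart (BTemp G₁)) (hA : IsGaloisObj A.obj)
    {g g' : G₁} (hgg' : φ g = φ g') :
    (pushforward φ hs hφ).map (ObjectProperty.homMk (galoisSurjOf hG A.obj hA g).hom : A ⟶ A) =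
      (pushforward φ hs hφ).map (ObjectProperty.homMk (galoisSurjOf hG A.obj hA g').hom) := by
  refine pushforward_map_eq_of_apply φ hs hφ _ _ (galoisBase hG A.obj hA) (g'⁻¹ * g) ?_ ?_
  · rw [map_mul, map_inv, hgg', inv_mul_cancel]
  · change A.obj.obj.ρ (g'⁻¹ * g) ((galoisSurjOf hG A.obj hA g).hom.hom.hom (galoisBase hG A.obj hA)) =
      (galoisSurjOf hG A.obj hA g').hom.hom.hom (galoisBase hG A.obj hA)
    rw [galoisSurjOf_apply_base, galoisSurjOf_apply_base, ← BTempConnected.ρ_mul_apply, mul_assoc, mul_inv_cancel,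
      mul_one]

/-- In particular `φ_*(galoisSurjOf_A(δ)) = id` for `δ ∈ Ker(φ)` — geometric automorphisms die in `D^cnst`.
[cite: MochizukiFrdII2008, Ex 1.3 (ii) p.11] -/
theorem pushforward_map_galoisSurjOf_of_ker (hG : IsTempered G₁) (A : ConnectedPart (BTemp G₁)) (hA : IsGaloisObj A.obj)
    {δ : G₁} (hδ : φ δ = 1) :
    (pushforward φ hs hφ).map (ObjectProperty.homMk (galoisSurjOf hG A.obj hA δ).hom : A ⟶ A) = 𝟙 _ := by
  rw [pushforward_map_galoisSurjOf_eq φ hs hφ hG A hA (g' := 1) (by rw [hδ, map_one]), map_one]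
  exact (pushforward φ hs hφ).map_id A

end CnstPushforward

/-! ### (C) The origin clauses at the genuine §5 data over `B^temp(Π^tp_X)⁰` -/

namespace ThetaFrobenioid

open CnstPushforward

variable {K : Type u₀} [Field K] {X : SemiGraphs.TemperedArithmeticGroup.{u₀} K} {D₀ : Type u₀} [Category.{v₀} D₀]
  {V : FrdIMonoidStub.{w}} {T₀ : RealifiedDivisorMonoids (D₀ := D₀) V}
  {VD : FrdICatStub.{u₀ + 1, u₀, w} (ConnectedPart (BTemp X.Pi))}
  {tf : TemperedFrobenioid T₀ (ConnectedPart (BTemp X.Pi)) VD} {hZ : tf.monoidType = MonoidType.Z}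
  {hP : ∀ A : (ConnectedPart (BTemp X.Pi))ᵒᵖ, IsPerfect (tf.Φ.carrier A)}
  {NH : Subgroup (Field.absoluteGaloisGroup K) → tf.category → ℕ+ → Prop} {A₀ : tf.category}
  {hA₀ : PreFrobenioid.IsFrobeniusTrivial tf.toElem A₀} {hA₀' : SemiGraphs.IsGaloisObj A₀.base.obj}
  {pullFrac : ∀ {A A' : (BiKummerSetting.mkOfConnectedTemperoid X tf hZ hP NH A₀ hA₀ hA₀').C} (_ : A' ⟶ A),
    (BiKummerSetting.mkOfConnectedTemperoid X tf hZ hP NH A₀ hA₀ hA₀').biratUnits A →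
      (BiKummerSetting.mkOfConnectedTemperoid X tf hZ hP NH A₀ hA₀ hA₀').biratUnits A'}
  {lv N : ℕ+} {T : ThetaEnvData.{max u₀ w} N}
  {θ : (BiKummerSetting.mkOfConnectedTemperoid X tf hZ hP NH A₀ hA₀ hA₀').biratUnits
    (BiKummerSetting.mkOfConnectedTemperoid X tf hZ hP NH A₀ hA₀ hA₀').Aodot}
  {Bl : (BiKummerSetting.mkOfConnectedTemperoid X tf hZ hP NH A₀ hA₀ hA₀').C}
  {Pl : (BiKummerSetting.mkOfConnectedTemperoid X tf hZ hP NH A₀ hA₀ hA₀').FractionPair θ Bl}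
  {Rl : (BiKummerSetting.mkOfConnectedTemperoid X tf hZ hP NH A₀ hA₀ hA₀').NthRoot θ Pl lv pullFrac}
  (h : ModelFrobenioid.Hypotheses tf.divisorMonoid tf.ratFnFunctor)
  (Q : FrobenioidTheta.ThetaSubquotientStub.{w} (ConnectedPart (BTemp X.Pi))) (odd_l : Odd (lv : ℕ))
  (R : (BiKummerSetting.mkOfConnectedTemperoid X tf hZ hP NH A₀ hA₀ hA₀').NthRoot Rl.root Rl.pair N pullFrac)
  (ιX : T.PiX ≃ₜ* X.Pi) (K' : Type w) [Field K'] (constEmb : K'ˣ →* tf.biratUnitsModel R.BN)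
  (constEmb_injective : Function.Injective constEmb)
  (hinvc : ∀ g : Aut R.AN.base,
    pull tf.divisorMonoid g.hom (ModelFrobenioid.div R.pair.num) = ModelFrobenioid.div R.pair.num)
  (hinvp : ∀ y : T.PiX, y ∈ T.PiYdd →
    pull tf.divisorMonoid ((BiKummerSetting.mkOfConnectedTemperoid X tf hZ hP NH A₀ hA₀ hA₀').galoisSurj R.AN.base
      R.αData.isGalois (ιX y)).hom (ModelFrobenioid.div R.pair.den) = ModelFrobenioid.div R.pair.den)
  (haug : IsOpenMap X.aug) {Dcnst : Type u₁} [Category.{v₁} Dcnst] (cnst : D₀ ⥤ Dcnst)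
  (G : ConnectedPart (BTemp (Field.absoluteGaloisGroup K)) ⥤ Dcnst)
  (e : tf.base ⋙ cnst ≅ QuasiTemperoid.pushforward X.aug.toMonoidHom X.aug_surjective haug ⋙ G)

/-- The setting's Galois surjection at a Galois object of `B^temp(Π^tp_X)⁰` is abc-iut-w5-d013's `galoisSurjOf` read in the full
subcategory (abc-iut-L2-t4's `mkOfConnectedTemperoid_galoisSurj_hom_hom`), as an equality of arrows.
[cite: MochizukiEtTh2009, Def 4.1 (ii) p.313 (PDF p.87)] -/
theorem galoisSurj_hom_eq_homMk (A : ConnectedPart (BTemp X.Pi))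
    (hA : (BiKummerSetting.mkOfConnectedTemperoid X tf hZ hP NH A₀ hA₀ hA₀').IsGaloisObj A) (g : X.Pi) :
    ((BiKummerSetting.mkOfConnectedTemperoid X tf hZ hP NH A₀ hA₀ hA₀').galoisSurj A hA g).hom =
      ObjectProperty.homMk (galoisSurjOf X.isTempered A.obj hA g).hom :=
  rfl

include e in
/-- **`D → D₀ → D^cnst` only sees the augmentation**: for `y, y' ∈ Π^tp_X̲` (the §2 data's group, identified with `Π^tp_X` by
`ιX`) with `aug(ιX y) = aug(ιX y')`, the automorphisms `ρ_N(y)`, `ρ_N(y')` of `B_N^bs` have the SAME image in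
`Aut_{D^cnst}((B_N^bs)^cnst)` — for every composite `tf.base ⋙ cnst` identified with the [FrdII] Ex. 1.3 (ii) push-forward along
`aug` ("the natural functor `D₀ → D^cnst` determined by `Π^tp_X ↠ G_K`", §3 p.298 (PDF p.72)).
[cite: MochizukiEtTh2009, §3 p.298 (PDF p.72); §5 p.331 (PDF p.105)] -/
theorem cnst_map_base_rho_eq_of_aug_eq {y y' : T.PiX} (hyy' : X.aug (ιX y) = X.aug (ιX y')) :
    cnst.map (tf.base.map (rhoOfBiKummerData R ιX y).hom) = cnst.map (tf.base.map (rhoOfBiKummerData R ιX y').hom) := by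
  change (tf.base ⋙ cnst).map _ = (tf.base ⋙ cnst).map _
  refine map_eq_of_iso_comp e ?_
  rw [rhoOfBiKummerData_apply, rhoOfBiKummerData_apply]
  refine map_conjAut_hom_eq _ _ ?_
  rw [galoisSurj_hom_eq_homMk, galoisSurj_hom_eq_homMk]
  exact pushforward_map_galoisSurjOf_eq X.aug.toMonoidHom X.aug_surjective haug X.isTempered R.AN.base R.αData.isGalois hyy'

include e in
/-- **The `hΔcnst` shape** (abc-iut-w5-d020's origin clause, GAP G-w5d020-2): a GEOMETRIC `δ` (`aug(ιX δ) = 1`) acts on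
`B_N^bs` by an automorphism `ρ_N(δ)` whose image in `Aut_{D^cnst}((B_N^bs)^cnst)` is the identity.
[cite: MochizukiEtTh2009, §3 p.298 (PDF p.72); Thm 5.6 proof p.329 (PDF p.103)] -/
theorem cnst_map_base_rho_eq_id_of_aug_eq_one {δ : T.PiX} (hδ : X.aug (ιX δ) = 1) :
    cnst.map (tf.base.map (rhoOfBiKummerData R ιX δ).hom) = 𝟙 (cnst.obj (tf.base.obj R.BN.base)) := by
  have h1 : X.aug (ιX δ) = X.aug (ιX 1) := by rw [hδ, map_one, map_one]
  rw [cnst_map_base_rho_eq_of_aug_eq R ιX haug cnst G e h1, map_one]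
  change cnst.map (tf.base.map (𝟙 R.BN.base)) = _
  rw [tf.base.map_id, cnst.map_id]

include e in
/-- **`hcnst` at the genuine §5 data over `B^temp(Π^tp_X)⁰`** (the residual of GAP G-L2d4-1 after p432786, VERBATIM shape of
`hfac_ofConnectedTemperoidData_of_cnst`'s binder): every `y ∈ Im(Π^tp_Y̲)` has the same image in `Aut_{D^cnst}((B_N^bs)^cnst)` as some
`h ∈ H_{B_N} = Im(Π^tp_Ÿ̲)` — from `hYdd` «`aug(ιX Π^tp_Ÿ̲)` exhausts `aug(ιX Π^tp_X̲)`» (`Ÿ` geometrically connected over `K = K̈`,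
§5 p.322 (PDF p.96); at the §1-setting junction: `Π^tp_Ÿ̲̲ ↠ G_K`).
[cite: MochizukiEtTh2009, §5 p.322 (PDF p.96); Lem 5.8 p.331 (PDF p.105)] -/
theorem hcnst_ofConnectedTemperoidData_of_pushforward
    (hYdd : ∀ y : T.PiX, ∃ k ∈ T.PiYdd, X.aug (ιX k) = X.aug (ιX y)) :
    ∀ y ∈ (ofConnectedTemperoidData h Q odd_l R ιX K' constEmb constEmb_injective hinvc hinvp).imPiY,
      ∃ k ∈ (ofConnectedTemperoidData h Q odd_l R ιX K' constEmb constEmb_injective hinvc hinvp).HB,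
        cnst.map (tf.base.map y.hom) = cnst.map (tf.base.map k.hom) := by
  intro y hy
  obtain ⟨y₀, -, rfl⟩ := Subgroup.mem_map.mp hy
  obtain ⟨k₀, hk₀, hk⟩ := hYdd y₀
  exact ⟨rhoOfBiKummerData R ιX k₀, Subgroup.mem_map_of_mem _ hk₀,
    cnst_map_base_rho_eq_of_aug_eq R ιX haug cnst G e hk.symm⟩

include h e in
/-- **abc-iut-w5-d020's T56-L09b binder `hconst` at the genuine §5 data over `B^temp(Π^tp_X)⁰`** (geometric `δ` fix the
rational-function component of every unit of `B_N`; `Discharge/Sec5UnitsFixedByGeometricOfCnst`, there ⟸ `Prop34Cnst` + `hΔcnst`):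
here ⟸ abc-iut-L2-t3's `Prop34Cnst T₀ cnst` + the identification `e` + «the kernel of the §2 data's augmentation is geometric for
`X.aug` through `ιX`» (`hker`; at the §1-setting junction `ιX = id` and the two augmentations coincide).
[cite: MochizukiEtTh2009, Prop 3.4 (ii) p.300 (PDF p.74); Thm 5.6 proof p.329 (PDF p.103); §3 p.298 (PDF p.72)] -/
theorem hconstΔ_ofConnectedTemperoidData_of_pushforward (hP34 : RealifiedDivisorMonoids.Prop34Cnst T₀ cnst)
    (hker : ∀ δ ∈ T.aug.ker, X.aug (ιX δ) = 1) :
    ∀ δ ∈ T.aug.ker, ∀ τ : ModelFrobenioid.units R.BN,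
      (tf.ratFnFunctor.map (rhoOfBiKummerData R ιX δ).hom.op).hom (ModelFrobenioid.unit τ.1.hom) =
        ModelFrobenioid.unit τ.1.hom :=
  fun δ hδ τ => tf.ratFnFunctor_map_unit_eq_of_cnst hP34 h.isDivisorial τ.2 _
    (cnst_map_base_rho_eq_id_of_aug_eq_one R ιX haug cnst G e (hker δ hδ))

end ThetaFrobenioid

end Literature.AnabelianGeometry.EtaleTheta

end
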